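import Summits.ResolutionOfSingularities.ResolutionOfSingularities.Theorems.FrobeniusClosingPatchingRelPerfectDepthTwoLocalHost
import Summits.ResolutionOfSingularities.ResolutionOfSingularities.Theorems.FrobeniusClosingPatchingRelPerfectDepthTwoEndGame
import HarnessLib

/-!
# Crux `PatchingRelPerfect` (stmt-ResolutionOfSingularities-16161), chain W5.2 — R4ˢ support, part 4:
# the X-side END-GAME of the depth-two rung with STALK-LOCAL hosts

[OURS · L1 W5.2 · rung tool] Fact-free, any dimension / characteristic / residue field; nothing here is a statement
of the manuscript under review. The END-GAME link of lead-2's chain «W₂ → S-T → D1^{2,1} → END-GAME → escaped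
packages → D5» in the form the tower delivers it: after the pure weight-two X-side tower (res-D-pv-016's
`TowerPow`, the graded format `DepthGraded.GradedFormat 2` of res-L1-w52-lead-1 propagated along it) the residual
`K′` has `𝓘_{E′}² ⊆ K′` and, on an open `V ⊇ E′` retracting onto `E′`, `K′|_V = r^*𝔟′ + 𝓘_{E′}²` with `𝔟′` of
order `≤ 1` everywhere (W₂ end state) — so at each point `x` of `D = V(K′ + 𝓘_{E′})` there is a LOCAL HOST
`h = r^♯(f)` (`𝔟′_e = (f)`, `ord f = 1`) with `K′_x = (h) + 𝓘_{E′,x}²` and `𝒪_x/(h)` regular, but no global one.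

* `endGame_local` — `S` regular local, `g : X ⟶ Spec S` a blowing up cosupported at the closed point, `X`
  Noetherian regular, `i : E ⟶ X` a closed immersion over the closed point with `𝓘_E` effective Cartier,
  `I𝒪_X = M · K` (`M` effective Cartier), `𝓘_E² ⊆ K`, `D := V(K + 𝓘_E)` regular, stalk-local hosts along `D`
  ⇒ ∃ a blowing up `X₂ ⟶ Spec S` cosupported at the closed point, `X₂` REGULAR, `I𝒪_{X₂}` LOCALLY PRINCIPAL.
  Proof = part 2's (`DepthTwo.endGame`): blow up `D` with weight one; the new exceptional divisor carries an r-d1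
  `DepthOneTargets.DepthOneInvariant` with threefold ideal `K₁|_{V(𝓖)}`; ONE `dictionaryStep_holds` (p496477)
  with that (regular) centre and new ideal `⊤`; `DepthOneTargets.dictionaryEnd_holds` — the two global facts
  `𝓖 ⊆ K₁` (`le_of_forall_stalkIdeal_le`) and «`V(K₁)` regular» (`Scheme.isRegular_subscheme_of_forall`) coming
  from part 3's `local_host_pointwise` over `D` and from `K₁ = 𝒪` off `D`;
* `companion_of_endGame_local` (`I ∈ 𝒞`, D5 `DepthOneTargets.towerContraction_holds`) and
  `atomConclusion_of_endGame_local` (the registered core's binder shape, `atomConclusion_of_companion'`).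

AI-written; AI review is weaker than expert review.

## References

* J. Kollár, *Lectures on Resolution of Singularities* (2007), 3.30.2, (3.111) Step 3. [Kollar2007]
* U. Görtz, T. Wedhorn, *Algebraic Geometry I*, 2nd ed. (2020), Prop. 13.91 (1), Prop. 13.96 (2). [GortzWedhorn2020]
* E. Bierstone, D. Grigoriev, P. Milman, J. Włodarczyk, *Effective Hironaka resolution and its complexity*
  (2011), §3.2 Lemma 3.2.1. [BierstoneGrigorievMilmanWlodarczyk2011]
* The Stacks Project, Tags 080A, 0804. [StacksProject]
-/

-- `Summit.<Summit>.<Sub>.Theorems` with `Sub = Summit` (single-conjunct summit, D-0017)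
set_option linter.dupNamespace false

noncomputable section

open CategoryTheory CategoryTheory.Limits AlgebraicGeometry TopologicalSpace
open Literature.AlgebraicGeometry.Resolution
open IsLocalRing

namespace Summit.ResolutionOfSingularities.ResolutionOfSingularities.Theorems

universe u

namespace DepthTwo
/-! ## The end-game with stalk-local hosts -/

/-- **THE X-SIDE END-GAME OF THE DEPTH-TWO RUNG, STALK-LOCAL HOST FORM** (the form delivered by the graded /
retraction format `K|_V = r^*𝔟 + 𝓘_E²|_V` on an open `V ⊇ E`, and by any Zariski-local host). `S` regular local,
`g : X ⟶ Spec S` a blowing up cosupported at the closed point, `X` Noetherian regular, `i : E ⟶ X` a closed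
immersion over the closed point with `𝓘_E = i.ker` effective Cartier, FORMAT `I𝒪_X = M · K` (`M` effective
Cartier), `𝓘_E² ⊆ K`, `D := V(K + 𝓘_E)` regular, and at every point `x ∈ D` a LOCAL HOST: `K_x = (h) + 𝓘_{E,x}²`
with `𝒪_{X,x}/(h)` regular. THEN there is a blowing up `X₂ ⟶ Spec S` cosupported at the closed point with `X₂`
regular and `I𝒪_{X₂}` locally principal. Proof: as `endGame` (blow up `D` with weight one; the new exceptional
divisor carries an r-d1 `DepthOneInvariant` with threefold ideal `K₁|_{V(𝓖)}`; one `dictionaryStep_holds` + the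
dictionary's end), the two global facts `𝓖 ⊆ K₁` and «`V(K₁)` regular» being proved STALKWISE
(`local_host_pointwise`; off `D` the blow-up is an isomorphism and `K₁ = 𝒪`). Fact-free.
[cite: Kollar2007, (3.111) Step 3] [cite: GortzWedhorn2020, Prop. 13.91 (1), Prop. 13.96 (2)]
[cite: BierstoneGrigorievMilmanWlodarczyk2011, §3.2 Lemma 3.2.1] -/
theorem endGame_local {S : Type u} [CommRing S] [IsRegularLocalRing S] (I : Ideal S)
    {E X : Scheme.{u}} (i : E ⟶ X) (g : X ⟶ Spec (.of S))
    [IsNoetherian X] (hX : Scheme.IsRegular X) [IsClosedImmersion i] (hiE : IsEffectiveCartier i.ker)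
    (hEpt : ∀ e : E, g.base (i.base e) = IsLocalRing.closedPoint S)
    (hg : ∃ K₀ : (Spec (.of S)).IdealSheafData, IsBlowup g K₀ ∧
      (K₀.support : Set (Spec (.of S))) ⊆ {IsLocalRing.closedPoint S})
    (M K : X.IdealSheafData) (hM : IsEffectiveCartier M)
    (hIMK : (affineBlowup.idealSheaf I).comap g = M * K)
    (hK2 : i.ker ^ 2 ≤ K) (hD : Scheme.IsRegular (K ⊔ i.ker).subscheme)
    (hhost : ∀ x ∈ (K ⊔ i.ker).support, ∃ h : X.presheaf.stalk x,
      stalkIdeal K x = Ideal.span {h} ⊔ stalkIdeal i.ker x * stalkIdeal i.ker x ∧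
        IsRegularLocalRing (X.presheaf.stalk x ⧸ Ideal.span {h})) :
    ∃ (X₂ : Scheme.{u}) (g₂ : X₂ ⟶ Spec (.of S)),
      (∃ K₀ : (Spec (.of S)).IdealSheafData, IsBlowup g₂ K₀ ∧
        (K₀.support : Set (Spec (.of S))) ⊆ {IsLocalRing.closedPoint S}) ∧
      Scheme.IsRegular X₂ ∧ IsLocallyPrincipal ((affineBlowup.idealSheaf I).comap g₂) := by
  classical
  set C : X.IdealSheafData := K ⊔ i.ker with hCdef
  have hKC : K ≤ C := le_sup_left
  have hKsupp : (K.support : Set X) ⊆ (C.support : Set X) := by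
    intro x hx
    have h1 : x ∈ ((i.ker ^ 2).support : Set X) := Scheme.IdealSheafData.support_antitone hK2 hx
    rw [Scheme.IdealSheafData.support_pow _ _ two_ne_zero] at h1
    rw [hCdef, Scheme.IdealSheafData.support_sup]
    exact ⟨hx, h1⟩
  -- STEP 1: blow `X` up along `C` (weight one)
  obtain ⟨X₁, σ, hσ⟩ := exists_isBlowup X C
  set G : X₁.IdealSheafData := C.comap σ with hGdef
  have hG : IsEffectiveCartier G := hσ.isEffectiveCartier
  haveI : IsProper σ := hσ.isProper
  haveI : IsLocallyNoetherian X₁ := LocallyOfFiniteType.isLocallyNoetherian σ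
  haveI : CompactSpace X₁ := QuasiCompact.compactSpace_of_compactSpace σ
  have hX₁N : IsNoetherian X₁ := {}
  have hX₁ : Scheme.IsRegular X₁ := hσ.isRegular_of_isRegular_subscheme hX hD
  set K₁ : X₁.IdealSheafData := controlledTransform σ C K 1 with hK₁def
  -- off the centre `K₁ = 𝒪`
  have hK₁top : ∀ y : X₁, σ y ∉ (C.support : Set X) → stalkIdeal K₁ y = ⊤ := by
    intro y hy
    have h1 : y ∉ (K.comap σ).support := by
      rw [Scheme.IdealSheafData.support_comap]
      exact fun h => hy (hKsupp h)
    exact top_le_iff.mp ((stalkIdeal_eq_top_of_not_mem_support h1).symm.le.trans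
      (stalkIdeal_mono (comap_le_controlledTransform σ C K 1) y))
  -- `𝓖 ⊆ K₁` and `V(K₁)` regular, stalkwise
  have hGK₁ : G ≤ K₁ := by
    refine le_of_forall_stalkIdeal_le fun y => ?_
    by_cases hy : σ y ∈ (C.support : Set X)
    · exact (local_host_pointwise hX hσ hiE hD hhost y hy).1
    · rw [hK₁top y hy]; exact le_top
  have hK₁reg : Scheme.IsRegular K₁.subscheme := by
    refine Scheme.isRegular_subscheme_of_forall _ fun y hyK => ?_
    by_cases hy : σ y ∈ (C.support : Set X)
    · exact (local_host_pointwise hX hσ hiE hD hhost y hy).2 hyK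
    · exact absurd (hK₁top y hy) fun h => (maximalIdeal.isMaximal (X₁.presheaf.stalk y)).ne_top
        (top_le_iff.mp (h ▸ (mem_support_iff_stalkIdeal_le K₁ y).mp hyK))
  -- the new exceptional divisor `G = V(𝓖)` as the carrier of a depth-ONE format
  have hkerG : G.subschemeι.ker = G := Scheme.IdealSheafData.ker_subschemeι G
  have hGreg : Scheme.IsRegular G.subscheme := hσ.isRegular_subscheme_comap hX hD
  have hCE : (C.support : Set X) ⊆ Set.range i.base := by
    intro x hx
    have hx' : x ∈ (i.ker.support : Set X) := Scheme.IdealSheafData.support_antitone le_sup_right hx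
    rw [Scheme.Hom.support_ker, i.isClosedEmbedding.isClosed_range.closure_eq] at hx'
    exact hx'
  have hCpt : (C.support : Set X) ⊆ g.base ⁻¹' {IsLocalRing.closedPoint S} := by
    intro x hx
    obtain ⟨e, rfl⟩ := hCE hx
    exact hEpt e
  have hGpt : ∀ p : G.subscheme,
      (σ ≫ g).base (G.subschemeι.base p) = IsLocalRing.closedPoint S := by
    intro p
    have h1 : G.subschemeι.base p ∈ ((C.comap σ).support : Set X₁) := by
      rw [← hGdef, ← Scheme.IdealSheafData.range_subschemeι]
      exact ⟨p, rfl⟩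
    rw [Scheme.IdealSheafData.support_comap] at h1
    have h2 : g.base (σ.base (G.subschemeι.base p)) = IsLocalRing.closedPoint S := hCpt h1
    simpa only [Scheme.Hom.comp_base, TopCat.coe_comp, Function.comp_apply] using h2
  have hg₁ : ∃ Q : (Spec (.of S)).IdealSheafData, IsBlowup (σ ≫ g) Q ∧
      (Q.support : Set (Spec (.of S))) ⊆ {IsLocalRing.closedPoint S} := by
    obtain ⟨K₀, hgK, hKsupp'⟩ := hg
    exact hgK.exists_isBlowup_comp_supported g K₀ σ C {IsLocalRing.closedPoint S} hKsupp' hσ hCpt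
  have hM₁ : IsEffectiveCartier (M.comap σ * G) := (hM.comap_of_isBlowup hσ).mul hG
  have hfmt : (affineBlowup.idealSheaf I).comap (σ ≫ g) = (M.comap σ * G) * K₁ := by
    rw [Scheme.IdealSheafData.comap_comp, hIMK, comap_mul, ← hσ.comap_mul_controlledTransform_one hKC,
      mul_assoc]
  have hinv : DepthOneTargets.DepthOneInvariant S I G.subscheme X₁ G.subschemeι (σ ≫ g)
      (K₁.comap G.subschemeι) :=
    { isNoetherian := hX₁N
      isRegular := hX₁
      isRegular_exc := hGreg
      isClosedImmersion := inferInstance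
      isEffectiveCartier_ker := by rw [hkerG]; exact hG
      map_eq_closedPoint := hGpt
      exists_isBlowup_supported := hg₁
      exists_format := ⟨M.comap σ * G, K₁, hM₁, by rw [hkerG]; exact hGK₁, rfl, hfmt⟩ }
  -- STEP 2: one dictionary step of programme r-d1 with centre `K₁|_G` (regular), new ideal `⊤`
  have hcentre : Scheme.IsRegular (K₁.comap G.subschemeι).subscheme := by
    rw [← isRegular_subscheme_map_iff_of_isClosedImmersion G.subschemeι (K₁.comap G.subschemeι),
      map_comap_of_ker_le K₁ G.subschemeι (by rw [hkerG]; exact hGK₁)]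
    exact hK₁reg
  obtain ⟨G', τ, hτ⟩ := exists_isBlowup G.subscheme (K₁.comap G.subschemeι)
  obtain ⟨X₂, i₂, g₂, hinv₂⟩ := dictionaryStep_holds S I G.subscheme X₁ G.subschemeι (σ ≫ g)
    (K₁.comap G.subschemeι) hinv G' τ (K₁.comap G.subschemeι) ⊤ hcentre le_rfl hτ
    (by rw [Scheme.IdealSheafData.mul_top])
  exact ⟨X₂, g₂, hinv₂.exists_isBlowup_supported, hinv₂.isRegular,
    DepthOneTargets.dictionaryEnd_holds S I G' X₂ i₂ g₂ ⊤ hinv₂ (Or.inl rfl)⟩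

/-- **The stalk-local end-game in the companion format `𝒞`** (D5 `towerContraction_holds`).
[cite: StacksProject, Tag 080A] [cite: Kollar2007, (3.111) Step 3] -/
theorem companion_of_endGame_local {S : Type u} [CommRing S] [IsRegularLocalRing S] {I : Ideal S}
    (hI : I ≠ ⊥) {E X : Scheme.{u}} (i : E ⟶ X) (g : X ⟶ Spec (.of S))
    [IsNoetherian X] (hX : Scheme.IsRegular X) [IsClosedImmersion i] (hiE : IsEffectiveCartier i.ker)
    (hEpt : ∀ e : E, g.base (i.base e) = IsLocalRing.closedPoint S)
    (hg : ∃ K₀ : (Spec (.of S)).IdealSheafData, IsBlowup g K₀ ∧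
      (K₀.support : Set (Spec (.of S))) ⊆ {IsLocalRing.closedPoint S})
    (M K : X.IdealSheafData) (hM : IsEffectiveCartier M)
    (hIMK : (affineBlowup.idealSheaf I).comap g = M * K)
    (hK2 : i.ker ^ 2 ≤ K) (hD : Scheme.IsRegular (K ⊔ i.ker).subscheme)
    (hhost : ∀ x ∈ (K ⊔ i.ker).support, ∃ h : X.presheaf.stalk x,
      stalkIdeal K x = Ideal.span {h} ⊔ stalkIdeal i.ker x * stalkIdeal i.ker x ∧
        IsRegularLocalRing (X.presheaf.stalk x ⧸ Ideal.span {h})) :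
    ∃ (Q : Ideal S) (m : ℕ), IsLocalRing.maximalIdeal S ^ m ≤ Q ∧
      ∃ (B : Scheme.{u}) (b : B ⟶ Spec (.of S)),
        IsBlowup b (affineBlowup.idealSheaf (I * Q)) ∧ Scheme.IsRegular B := by
  obtain ⟨X₂, g₂, ⟨K₀, hg₂, hK₀⟩, hX₂, hlp⟩ := endGame_local I i g hX hiE hEpt hg M K hM hIMK hK2 hD hhost
  exact DepthOneTargets.towerContraction_holds S I hI X₂ g₂ K₀ hg₂ hK₀ hX₂ hlp

/-- **The stalk-local end-game in the registered core's binder shape** (via `atomConclusion_of_companion'`). NOT a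
statement of the manuscript under review. [cite: StacksProject, Tag 080A] [cite: Kollar2007, (3.111) Step 3] -/
theorem atomConclusion_of_endGame_local {S : Type u} [CommRing S] [IsRegularLocalRing S] {I : Ideal S}
    (hI : I ≠ ⊥) {E X : Scheme.{u}} (i : E ⟶ X) (g : X ⟶ Spec (.of S))
    [IsNoetherian X] (hX : Scheme.IsRegular X) [IsClosedImmersion i] (hiE : IsEffectiveCartier i.ker)
    (hEpt : ∀ e : E, g.base (i.base e) = IsLocalRing.closedPoint S)
    (hg : ∃ K₀ : (Spec (.of S)).IdealSheafData, IsBlowup g K₀ ∧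
      (K₀.support : Set (Spec (.of S))) ⊆ {IsLocalRing.closedPoint S})
    (M K : X.IdealSheafData) (hM : IsEffectiveCartier M)
    (hIMK : (affineBlowup.idealSheaf I).comap g = M * K)
    (hK2 : i.ker ^ 2 ≤ K) (hD : Scheme.IsRegular (K ⊔ i.ker).subscheme)
    (hhost : ∀ x ∈ (K ⊔ i.ker).support, ∃ h : X.presheaf.stalk x,
      stalkIdeal K x = Ideal.span {h} ⊔ stalkIdeal i.ker x * stalkIdeal i.ker x ∧
        IsRegularLocalRing (X.presheaf.stalk x ⧸ Ideal.span {h}))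
    (T : Scheme.{u}) (f : T ⟶ Spec (.of S)) (hf : IsBlowup f (affineBlowup.idealSheaf I)) :
    ∃ (J : T.IdealSheafData) (T' : Scheme.{u}) (π : T' ⟶ T), J ≠ ⊥ ∧
      (∀ t : T, t ∈ J.support → f.base t = IsLocalRing.closedPoint S) ∧
      IsBlowup π J ∧ Scheme.IsRegular T' :=
  atomConclusion_of_companion' hI
    (companion_of_endGame_local hI i g hX hiE hEpt hg M K hM hIMK hK2 hD hhost) T f hf

end DepthTwo

end Summit.ResolutionOfSingularities.ResolutionOfSingularities.Theorems

end
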